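import Literature.AnabelianGeometry.EtaleTheta.XuuCocycleOfClassLevel
import Literature.AnabelianGeometry.EtaleTheta.Discharge.Sec2DeltaThetaTorsionFree
import Literature.AnabelianGeometry.EtaleTheta.Discharge.Sec2ThetaOrbitClasses
import Literature.AnabelianGeometry.EtaleTheta.ThetaLiftUnique
import Mathlib.Tactic.LinearCombination
import Mathlib.Tactic.Module
import HarnessLib

/-!
# [EtTh] Prop. 2.2 (ii) / Def. 2.7 in the §1 model: the `l·Z`-translate clause of the choice `X̲̲`
# DERIVED from Prop. 1.5 (ii), (iii) (the `Z`-action on `η̈^Θ` is coherent across powers)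

Mochizuki, *The étale theta function and its Frobenioid-theoretic manifestations*, Publ. RIMS **45**
(2009): Prop. 1.5 (ii), (iii) (PRIMS PDF p. 23: "`F̈¹/F̈² = Hom((Δ^tp_Ÿ)^ell/Δ_Θ, Δ_Θ)`", "`F̈² =
H¹(G_K̈, Δ_Θ)`"; "`η̈^Θ ↦ η̈^Θ − 2a·log(Ü) − (a²/2)·log(q_X) + log(O^×_K̈)`"), §1 p. 12 ("`Δ_Θ (≅ Ẑ(1))`"),
Def. 2.7 (p. 41: "`Π^tp_X̲/Π^tp_Ÿ ≅ (l·Z) × μ₂`") [cite: MochizukiEtTh2009, Prop 1.5 (iii) p.23].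

Cell abc-iut, layer L2, item N3 (seat abc-iut-L2-t7), row "x1 ⋈ §1 JUNCTION". PROOF-ONLY (0 definitions).
`XuuCocycleOfClassLevel.lean` builds the choice `X̲̲` (seat abc-iut-L2-t8's `DoubleUnderline`) from the
§1 inputs and two class-level clauses: the sign clause `(P14ii-cl)` and the translate clause "some lift `t`
of `l ∈ Z` moves `η̈^Θ` by an `l`-th power". THIS FILE PROVES THE TRANSLATE CLAUSE from the named §1 facts
`Prop15iii`, `Prop15ii` (seat abc-iut-L2-t1), `K = K̈`, and the torsion-freeness of `Δ_Θ` (seat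
abc-iut-L2-t8's `deltaTheta_torsionfree`, from the guard `IsEtThOrigin`):

The printed `Z`-action formula carries the indeterminacy "`+ log(O^×_K̈)`", one unit `u_σ` for EVERY
`σ ∈ Π^tp_X` — but all for the SAME lift `x'` of `η̈^Θ` to `(Π^tp_Ÿ)^Θ`, and conjugation is an ACTION. For
a lift `s` of `1 ∈ Z` write `s·x' = x'·L^{-2}·Q^{-1}·U₁` (`L = log(Ü)`, `Q = log(q̈)`, `U₁ = log(u₁)`) and
apply the formula at `s²` as well: since `s` fixes `F̈² = log(K̈^×)` (seat abc-iut-w5-d234,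
`conj_inflTheta_eq_self_of_aug_mem_GKdd`), comparing `s·(s·x')` with `s²·x'` gives
`(s·L · L⁻¹ · Q⁻¹)² ∈ F̈²`; and `F̈¹/F̈²` — indeed `H¹((Π^tp_Ÿ)^Θ)/F̈² ↪ H¹((Δ^tp_Ÿ)^Θ, Δ_Θ) = Hom(−, Δ_Θ)` — has
NO `2`-TORSION because `Δ_Θ` is torsion-free (`mem_Fdd2_of_sq_mem_Fdd2`). Hence `N := s·L·L⁻¹·Q⁻¹ ∈ F̈²`
is `s`-fixed, `sʲ·L = L·Qʲ·Nʲ`, and by induction `sʲ·x' = x'·L^{-2j}·Q^{-j²}·N^{-j(j-1)}·U₁^{j}`; at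
`j = l` every exponent is a multiple of `l`: `s^l·x' = x'·(L^{-2}·Q^{-l}·N^{-(l-1)}·U₁)^l`
(`conj_pow_lift_eq`), whence the translate clause for `η̈^Θ` itself (`exists_translate_class_of_prop15`)
and, with the sign clause `hμ₂`, `nonempty_doubleUnderline_of_prop15_of_signClause`; the sign clause
is seat abc-iut-L2-t1's `Sec1DeckSign.exists_sq_eq_one_and_conj_eq` (Prop. 1.5 (iii) alone), joined in
`XuuCocycleOfSectionOne.lean`. No new `Prop` fact; nothing of [EtTh] is asserted; typed ≠ endorsed; no
side is taken on any disputed claim.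
-/

noncomputable section

namespace Literature.AnabelianGeometry.EtaleTheta

open Literature.AnabelianGeometry.SemiGraphs
open scoped IsMulCommutative

/-! ### Generic: no torsion in `H¹` of a subgroup centralising torsion-free coefficients -/

namespace ContH1

variable {G G' : Type*} [Group G] [TopologicalSpace G]
  [Group G'] [TopologicalSpace G'] [IsTopologicalGroup G']
  {φ : G →* G'} {A : Subgroup G'} [A.Normal] [IsMulCommutative A]

/-- If `M ≤ G` centralises the coefficients `A` (through `φ`) and `A` has no `n`-torsion, then
`H¹(M, A)` has no `n`-torsion: a class with `rⁿ = 1` is trivial (on such `M` coboundaries vanish and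
cocycles are homomorphisms, so `rⁿ = 1` means `f(m)ⁿ = 1` pointwise). [cite: NeukirchSchmidtWingberg2008, I §2] -/
theorem eq_one_of_pow_eq_one_of_centralizes {M : Subgroup G}
    (hcomm : ∀ g ∈ M, ∀ a : G', a ∈ A → φ g * a = a * φ g) {n : ℕ}
    (htf : ∀ a : A, a ^ n = 1 → a = 1) (r : ContH1 φ A M) (hr : r ^ n = 1) : r = 1 := by
  induction r using QuotientGroup.induction_on with
  | H f =>
    have h1 : (QuotientGroup.mk (f ^ n) : ContH1 φ A M) = 1 := by
      rw [QuotientGroup.mk_pow]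
      exact hr
    rw [QuotientGroup.eq_one_iff, Subgroup.mem_subgroupOf, mem_contCoboundaries_iff] at h1
    obtain ⟨a, ha⟩ := h1
    have hf : f = 1 := by
      apply Subtype.ext
      funext m
      have e := congrFun ha m
      have hc : MulAut.conjNormal (φ (m : G)) a = a := by
        apply Subtype.ext
        rw [MulAut.conjNormal_apply, hcomm m.1 m.2 _ a.2, mul_inv_cancel_right]
      rw [hc, mul_inv_cancel, SubgroupClass.coe_pow, Pi.pow_apply] at e
      rw [OneMemClass.coe_one, Pi.one_apply]
      exact htf _ e
    rw [hf, QuotientGroup.mk_one]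
    rfl

end ContH1

namespace ThetaSetting

variable {p : ℕ} [Fact p.Prime] {D : ThetaSetting p}

/-! ### `F̈²` is fixed by all of `Π^tp_X`; `H¹((Π^tp_Ÿ)^Θ)/F̈²` has no `2`-torsion -/

/-- **Classes of `F̈²` are fixed by conjugation by EVERY `σ ∈ Π^tp_X`** under `K = K̈`, on
`H¹((Π^tp_Ÿ)^Θ, Δ_Θ)` itself: seat abc-iut-w5-d234's inflated form `conj_inflTheta_eq_self_of_aug_mem_GKdd`
(Prop. 1.5 (ii): `Π^tp_X` acts on `F̈² = H¹(G_K̈, Δ_Θ)` through `G_K̈`) pulled back along the injective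
inflation (`inflTheta_injective`). [cite: MochizukiEtTh2009, Prop 1.5 (ii) p.23] -/
theorem conj_eq_self_of_mem_Fdd2_of_sec2Hyps (hC : D.Compat) (hS : D.Sec2Hyps)
    {z : D.H1Theta (D.GtpYdd.map D.toTheta)}
    (hz : z ∈ (Fdd2 : Subgroup (D.H1Theta (D.GtpYdd.map D.toTheta)))) (σ : D.PiTemp) :
    haveI := hC.GtpYddTheta_normal
    ContH1.conj (MonoidHom.id D.GtpTheta) D.DeltaTheta (D.toTheta σ) z = z := by
  haveI := hC.GtpYddTheta_normal
  haveI := hC.GtpYdd_normal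
  have hσ : D.aug.toMonoidHom σ ∈ D.GKdd := by
    have e : D.GKdd = D.GK := hS.GKdd_eq
    rw [e]
    exact D.aug_mem_GK σ
  apply D.inflTheta_injective D.GtpYdd
  have e := ContH1.infl_conj (A := D.DeltaTheta) (ψ := D.toTheta) (hψ := D.continuous_toTheta)
    (H₀ := D.GtpYdd) (H' := D.GtpYdd.map D.toTheta) le_rfl σ z
  exact e.trans (conj_inflTheta_eq_self_of_aug_mem_GKdd hC hσ hz)

/-- **`F̈²` absorbs square roots** ("`F̈¹/F̈² = Hom((Δ^tp_Ÿ)^ell/Δ_Θ, Δ_Θ)`", torsion-free): a class `y` of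
`H¹((Π^tp_Ÿ)^Θ, Δ_Θ)` with `y² ∈ F̈²` lies in `F̈²` — `F̈²` is the kernel of restriction to `(Δ^tp_Ÿ)^Θ`,
which centralises `Δ_Θ`, and `H¹((Δ^tp_Ÿ)^Θ, Δ_Θ) = Hom(−, Δ_Θ)` has no `2`-torsion because `Δ_Θ (≅ Ẑ(1))`
is torsion-free (seat abc-iut-L2-t8's `deltaTheta_eq_one_of_sq_eq_one`, from the guard `IsEtThOrigin`).
[cite: MochizukiEtTh2009, Prop 1.5 (ii) p.23] -/
theorem mem_Fdd2_of_sq_mem_Fdd2 (hO : D.IsEtThOrigin) {y : D.H1Theta (D.GtpYdd.map D.toTheta)}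
    (hy : y ^ 2 ∈ (Fdd2 : Subgroup (D.H1Theta (D.GtpYdd.map D.toTheta)))) :
    y ∈ (Fdd2 : Subgroup (D.H1Theta (D.GtpYdd.map D.toTheta))) := by
  have hM : (D.DtpYddN 1).map D.toTheta ≤ D.GtpYdd.map D.toTheta := Subgroup.map_mono inf_le_left
  change ContH1.res (MonoidHom.id D.GtpTheta) D.DeltaTheta hM y = 1
  have hy' : ContH1.res (MonoidHom.id D.GtpTheta) D.DeltaTheta hM (y ^ 2) = 1 := hy
  rw [map_pow] at hy'
  refine ContH1.eq_one_of_pow_eq_one_of_centralizes (fun g hg a ha => ?_) (fun a ha2 => ?_) _ hy'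
  · rw [MonoidHom.id_apply]
    exact (D.ker_thetaToEll_central a ha g (Subgroup.map_mono inf_le_right hg)).symm
  · exact Subtype.ext (D.deltaTheta_eq_one_of_sq_eq_one hO a.2 (by
      have := congrArg Subtype.val ha2; simpa using this))

namespace EtaleThetaData

variable {E : D.EtaleThetaData}

/-! ### The `Z`-action on the lift of `η̈^Θ`: coherence across powers -/

/-- **The powers of a lift `s` of `1 ∈ Z` on the lift `x'` of a theta class** (Prop. 1.5 (iii) made
coherent): if `s·x' = x'·L^{-2}·Q^{-1}·U₁` and `N := s·L·L⁻¹·Q⁻¹`, `Q`, `U₁` are `s`-fixed, then for all `j`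
`sʲ·x' = x'·L^{-2j}·Q^{-j²}·N^{-j(j-1)}·U₁ʲ`. Pure bookkeeping in the commutative group
`H¹((Π^tp_Ÿ)^Θ, Δ_Θ)`. [cite: MochizukiEtTh2009, Prop 1.5 (iii) p.23] -/
theorem conj_pow_lift_eq (hC : D.Compat) {x' L Q U₁ N : D.H1Theta (D.GtpYdd.map D.toTheta)}
    {s : D.PiTemp}
    (h1 : haveI := hC.GtpYddTheta_normal
      ContH1.conj (MonoidHom.id D.GtpTheta) D.DeltaTheta (D.toTheta s) x' =
        x' * L ^ (-2 : ℤ) * Q ^ (-1 : ℤ) * U₁)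
    (hL : haveI := hC.GtpYddTheta_normal
      ContH1.conj (MonoidHom.id D.GtpTheta) D.DeltaTheta (D.toTheta s) L = N * L * Q)
    (hQ : haveI := hC.GtpYddTheta_normal
      ContH1.conj (MonoidHom.id D.GtpTheta) D.DeltaTheta (D.toTheta s) Q = Q)
    (hU : haveI := hC.GtpYddTheta_normal
      ContH1.conj (MonoidHom.id D.GtpTheta) D.DeltaTheta (D.toTheta s) U₁ = U₁)
    (hN : haveI := hC.GtpYddTheta_normal
      ContH1.conj (MonoidHom.id D.GtpTheta) D.DeltaTheta (D.toTheta s) N = N) (j : ℕ) :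
    haveI := hC.GtpYddTheta_normal
    ContH1.conj (MonoidHom.id D.GtpTheta) D.DeltaTheta (D.toTheta (s ^ j)) x' =
      x' * L ^ (-(2 * (j : ℤ))) * Q ^ (-((j : ℤ) * j)) * N ^ (-((j : ℤ) * (j - 1))) * U₁ ^ (j : ℤ) := by
  haveI := hC.GtpYddTheta_normal
  induction j with
  | zero =>
    simp only [pow_zero, map_one, ContH1.conj_one_apply, Nat.cast_zero, mul_zero, neg_zero, zpow_zero,
      mul_one, zero_mul]
  | succ j ih =>
    rw [pow_succ', map_mul, ContH1.conj_mul_apply, ih]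
    simp only [map_mul, map_zpow, h1, hL, hQ, hU, hN]
    apply (Additive.ofMul : D.H1Theta (D.GtpYdd.map D.toTheta) ≃ _).injective
    simp only [ofMul_mul, ofMul_zpow]
    push_cast
    module

/-- **The translate clause from Prop. 1.5 (ii), (iii)**: for every theta class `x ∈ O^×_K̈ · η̈^Θ` and
every lift `s` of `1 ∈ Z` (`toZ s = 1`), the lift `t := s^l` of `l ∈ Z` moves `x` by an `l`-th power:
`t·x = x·κ^l` in `H¹(Π^tp_Ÿ, Δ_Θ)`. Inputs: `Prop15iii` (the `Z`-action formula with its unit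
indeterminacy), `Prop15ii` (`F̈² = log(K̈^×)`, `log(Ü) ∈ F̈¹`), `K = K̈`, and `IsEtThOrigin` (torsion-freeness
of `Δ_Θ`). [cite: MochizukiEtTh2009, Prop 1.5 (iii) p.23] -/
theorem exists_conj_pow_eq_mul_pow_of_prop15 (hC : D.Compat) (hS : D.Sec2Hyps) (hO : D.IsEtThOrigin)
    (h15 : Prop15iii E hC) (h15ii : Prop15ii E.toKummerData hC) {x : D.H1 D.GtpYdd}
    (hx : x ∈ E.thetaClasses) {s : D.PiTemp} (hs : D.toZ s = Multiplicative.ofAdd 1) (l : ℕ) :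
    ∃ κ : D.H1 D.GtpYdd,
      haveI := hC.GtpYdd_normal
      ContH1.conj D.toTheta D.DeltaTheta (s ^ l) x = x * κ ^ l := by
  haveI := hC.GtpYdd_normal
  haveI := hC.GtpYddTheta_normal
  obtain ⟨x', ⟨hx', -, hΦ⟩, -⟩ := h15 x hx
  set L := E.logUdd with hLdef
  set Q := E.kumYdd (E.toKddHat D.qddUnit) with hQdef
  -- Kummer classes of `K̈^×` lie in `F̈²` and are fixed by every `σ`
  have hkum : ∀ (w : (↥D.Kdd)ˣ) (σ : D.PiTemp),
      ContH1.conj (MonoidHom.id D.GtpTheta) D.DeltaTheta (D.toTheta σ) (E.kumYdd (E.toKddHat w)) =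
        E.kumYdd (E.toKddHat w) := fun w σ =>
    conj_eq_self_of_mem_Fdd2_of_sec2Hyps hC hS (by rw [h15ii.Fdd2_eq]; exact ⟨_, rfl⟩) σ
  -- the formula at `s` (`a = 1`) and at `s²` (`a = 2`)
  have ha1 : Multiplicative.toAdd (D.toZ s) = 1 := by rw [hs, toAdd_ofAdd]
  have ha2 : Multiplicative.toAdd (D.toZ (s * s)) = 2 := by rw [map_mul, toAdd_mul, ha1]; rfl
  obtain ⟨u₁, -, h1⟩ := hΦ s
  obtain ⟨u₂, -, h2⟩ := hΦ (s * s)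
  rw [ha1] at h1
  rw [ha2] at h2
  set U₁ := E.kumYdd (E.toKddHat u₁) with hU₁def
  set U₂ := E.kumYdd (E.toKddHat u₂) with hU₂def
  have hU₁ := hkum u₁ s
  have hU₂ := hkum u₂ s
  have hQ := hkum D.qddUnit s
  rw [← hU₁def] at hU₁
  rw [← hQdef] at hQ
  -- `N := s·L · L⁻¹ · Q⁻¹` has `N² ∈ F̈²`, hence `N ∈ F̈²`, hence is `s`-fixed
  set φ : D.H1Theta (D.GtpYdd.map D.toTheta) →* D.H1Theta (D.GtpYdd.map D.toTheta) :=
    ContH1.conj (MonoidHom.id D.GtpTheta) D.DeltaTheta (D.toTheta s) with hφdef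
  set N := φ L * L⁻¹ * Q⁻¹ with hNdef
  have h1' : φ x' = x' * L ^ (-2 : ℤ) * Q ^ (-1 : ℤ) * U₁ := by
    rw [h1]; norm_num
  have h2' : φ (φ x') = x' * L ^ (-4 : ℤ) * Q ^ (-4 : ℤ) * U₂ := by
    rw [hφdef, ← ContH1.conj_mul_apply, ← map_mul, h2]; norm_num
  have hN2 : N ^ 2 = U₁ ^ 2 * U₂⁻¹ := by
    have e : φ (φ x') = φ x' * φ L ^ (-2 : ℤ) * Q ^ (-1 : ℤ) * U₁ := by
      conv_lhs => rw [h1']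
      rw [map_mul, map_mul, map_mul, map_zpow, map_zpow, hQ, hU₁]
    rw [h2', h1'] at e
    apply (Additive.ofMul : D.H1Theta (D.GtpYdd.map D.toTheta) ≃ _).injective
    have e' := congrArg (Additive.ofMul : D.H1Theta (D.GtpYdd.map D.toTheta) ≃ _) e
    simp only [hNdef, ofMul_mul, ofMul_zpow, ofMul_pow, ofMul_inv] at e' ⊢
    linear_combination (norm := module) e'
  have hNmem : N ∈ (Fdd2 : Subgroup (D.H1Theta (D.GtpYdd.map D.toTheta))) := by
    apply mem_Fdd2_of_sq_mem_Fdd2 hO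
    rw [hN2]
    have hmem : ∀ w : (↥D.Kdd)ˣ,
        E.kumYdd (E.toKddHat w) ∈ (Fdd2 : Subgroup (D.H1Theta (D.GtpYdd.map D.toTheta))) :=
      fun w => by rw [h15ii.Fdd2_eq]; exact ⟨_, rfl⟩
    exact mul_mem (pow_mem (hmem u₁) 2) (inv_mem (hmem u₂))
  have hN : φ N = N := conj_eq_self_of_mem_Fdd2_of_sec2Hyps hC hS hNmem s
  have hL : φ L = N * L * Q := by
    rw [hNdef]
    apply (Additive.ofMul : D.H1Theta (D.GtpYdd.map D.toTheta) ≃ _).injective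
    simp only [ofMul_mul, ofMul_inv]
    abel
  -- iterate to `s^l`
  have key := conj_pow_lift_eq hC h1' hL hQ hU₁ hN l
  refine ⟨D.inflTheta D.GtpYdd (L ^ (-2 : ℤ) * Q ^ (-(l : ℤ)) * N ^ (-((l : ℤ) - 1)) * U₁), ?_⟩
  have hinfl : D.inflTheta D.GtpYdd (ContH1.conj (MonoidHom.id D.GtpTheta) D.DeltaTheta
      (D.toTheta (s ^ l)) x') = ContH1.conj D.toTheta D.DeltaTheta (s ^ l) (D.inflTheta D.GtpYdd x') :=
    ContH1.infl_conj (A := D.DeltaTheta) (ψ := D.toTheta) (hψ := D.continuous_toTheta)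
      (H₀ := D.GtpYdd) (H' := D.GtpYdd.map D.toTheta) le_rfl (s ^ l) x'
  rw [← hx', ← hinfl, key, ← map_pow, ← map_mul]
  congr 1
  apply (Additive.ofMul : D.H1Theta (D.GtpYdd.map D.toTheta) ≃ _).injective
  simp only [ofMul_mul, ofMul_zpow, ofMul_pow]
  module

/-- **The translate clause of the `X̲̲`-construction from the §1 facts**: there is a lift `t` of `l ∈ Z`
(`toZ t = l`) with `t·η̈^Θ = η̈^Θ·κ^l` for some class `κ` — from `Prop15iii`, `Prop15ii`, `K = K̈`,
`IsEtThOrigin`. (This RETRACTS the earlier reading that the printed indeterminacy "`+ log(O^×_K̈)`" blocks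
the clause: it is coherent across the powers of one lift.) [cite: MochizukiEtTh2009, Def 2.7 p.41] -/
theorem exists_translate_class_of_prop15 (hC : D.Compat) (hS : D.Sec2Hyps) (hO : D.IsEtThOrigin)
    (h15 : Prop15iii E hC) (h15ii : Prop15ii E.toKummerData hC) (l : ℕ) :
    ∃ t : D.PiTemp, D.toZ t = Multiplicative.ofAdd (l : ℤ) ∧ ∃ κ : D.H1 D.GtpYdd,
      haveI := hC.GtpYdd_normal
      ContH1.conj D.toTheta D.DeltaTheta t E.etaDd = E.etaDd * κ ^ l := by
  obtain ⟨s, hs⟩ := D.toZ_surjective (Multiplicative.ofAdd 1)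
  refine ⟨s ^ l, ?_, exists_conj_pow_eq_mul_pow_of_prop15 hC hS hO h15 h15ii E.etaDd_mem_thetaClasses hs l⟩
  rw [map_pow, hs, ← ofAdd_nsmul, nsmul_eq_mul, mul_one]

/-- **`X̲̲` exists from the §1 facts and the sign clause**: `Compat`, `K = K̈`, `IsEtThOrigin`, the named
facts `Prop15iii`, `Prop15ii`, the cyclotome identification `CyclotomeMod 1 l`, `l` odd, and the sign
clause `(P14ii-cl)` `hμ₂` (itself a consequence of `Prop15iii` — seat abc-iut-L2-t1's
`Sec1DeckSign.exists_sq_eq_one_and_conj_eq`; joined in `XuuCocycleOfSectionOne.lean`).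
[cite: MochizukiEtTh2009, Def 2.7 p.41] -/
theorem nonempty_doubleUnderline_of_prop15_of_signClause (hC : D.Compat) (hS : D.Sec2Hyps)
    (hO : D.IsEtThOrigin) (h15 : Prop15iii E hC) (h15ii : Prop15ii E.toKummerData hC) {l : ℕ+}
    (μ : D.CyclotomeMod 1 l) (hl : Odd (l : ℕ))
    (hμ₂ : ∀ ε ∈ D.GtpY, ∃ κ₁ : D.H1 D.GtpYdd, κ₁ ^ 2 = 1 ∧
      haveI := hC.GtpYdd_normal
      ContH1.conj D.toTheta D.DeltaTheta ε E.etaDd = E.etaDd * κ₁) :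
    Nonempty (E.DoubleUnderline l) := by
  haveI := hC.GtpYdd_normal
  obtain ⟨t, htZ, ht⟩ := exists_translate_class_of_prop15 hC hS hO h15 h15ii (l : ℕ)
  exact nonempty_doubleUnderline_of_classLevel hC hS h15 μ hl hμ₂ htZ ht

end EtaleThetaData

end ThetaSetting

end Literature.AnabelianGeometry.EtaleTheta

end
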